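import Summits.BirchSwinnertonDyer.BirchSwinnertonDyer.Theorems.KimAtThreeD7uTamagawaFreeStructures
import HarnessLib

/-!
# The TAMAGAWA-FREE bad places, III (`T_pE`-level): at a finite `w ∤ p` with `p ∤ c_w`,
# EVERY class of `H¹(ℚ_w, T_pE)` is unramified — `H¹_ur(ℚ_w, T_pE) = H¹(ℚ_w, T_pE)` and
# `H¹(I_w, T_pE)^{Frob} = 0`, i.e. `[H¹(ℚ_w, T_pE) : H¹_ur(ℚ_w, T_pE)] = (c_w)_p = 1`
# (cell `bsd-addord`, seat w2-tamdiv gen 3; route W2 `KimAtThreeKolyvagin`, items 19562 / 19560, «TamDiv∞»)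

HONEST FRAMING: TOOL theorems (no definition, no named fact, no `sorry`); closes nothing by itself;
nothing is booked; BSD is not proved by any of this.  w2-acc5 g3's E-free local index package
(`KimAtThreeDeepUpperOffStratumLocalIndex`: `0 → H¹_ur(ℚ_w, T) → H¹(ℚ_w, T) → H¹(I_w, T)^{Fr} → 0` for
`T = T_pE|_{Γ_{ℚ_w}}`) left «the E-SPECIFIC order `#H¹(I_w, T_pE)^{Fr} = (c_w)_p`» open.  Parts I–II
(`KimAtThreeD7uTamagawaFreePlaces`, `…Structures`) proved the exponent-`0` case at every finite level
(`𝓕_u(w) = 𝓕_can(w) = H¹_ur(ℚ_w, E[p^{k+1}])` when `p ∤ c_w`).  This file passes to the Tate module: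
**if `p ∤ c_w` (`w ∤ p` finite, ANY reduction type) then `res_{I_w} : H¹(ℚ_w, T_pE) → H¹(I_w, T_pE)` is
ZERO**, so `H¹_ur(ℚ_w, T_pE) = H¹(ℚ_w, T_pE)` and (by acc5's surjection `H¹(ℚ_w, T) ↠ H¹(I_w, T)^{Fr}`)
`H¹(I_w, T_pE)^{Fr} = 0`: the `p ∤ c_w` half of Rubin's Lemma 1.3.5 / Büyükboduk's Remark 2
(`[H¹_f : H¹_ur] = #(W^{I}/W^{I}_{div})^{Fr} = (c_w)_p`) for `T_pE`, in n1011's continuous-cohomology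
currency.

## What

* §1 (combinatorics) `exists_seq_of_finite_tower` — KÖNIG's lemma for an `ℕ`-tower of finite
  non-empty sets `S n` with a map `f` sending `S (n+1)` into `S n`: a compatible sequence `a n ∈ S n`,
  `f (a (n+1)) = a n` exists (infinitely extendable elements; pigeonhole on the finite fibres).
* §2 **`resSubgroup_absInertia_eq_zero_of_not_dvd_localTamagawaNumber`** — for `W/ℚ` elliptic, a prime
  `p`, a finite `w ∤ p` with `p ∤ c_w` and ANY `y ∈ H¹(ℚ_w, T_pE)`: `res_{I_w} y = 0`.  PROOF: for a
  cocycle `η` of `y`, each reduction `π_{k+1} ∘ η` has class in `𝓕_can(w) = H¹_ur(ℚ_w, E[p^k·p])` (Part II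
  `propagatedSelmerStructure_inr_eq_unramifiedSubgroup_of_not_dvd_localTamagawaNumber`), i.e. is the
  coboundary on `I_w` of some `m_k ∈ E[p^k·p]` (`LocBridge.mem_unramifiedSubgroup_one_iff_exists`); the
  sets of such `m_k` are finite, non-empty and mapped into each other by `[p]`, so §1 gives a compatible
  choice `t = (m_k)_k ∈ T_pE` with `η|_{I_w} = ∂t` (Mittag-Leffler in degree `1`:
  `lim¹ E[p^k]^{I_w} = 0`).
* §3 `unramifiedSubgroup_tate_eq_top_of_not_dvd_localTamagawaNumber` (`H¹_ur(ℚ_w, T_pE) = H¹(ℚ_w, T_pE)`,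
  via gen 2's `mem_unramifiedSubgroup_iff_resSubgroup_absInertia_eq_zero`) and
  **`eq_zero_of_conjMap_eq_of_not_dvd_localTamagawaNumber`** (`H¹(I_w, T_pE)^{Fr} = 0`: a
  Frobenius-invariant class of `H¹(I_w, T_pE)` is a restriction by acc5's
  `exists_resSubgroup_inertia_eq_of_conjMap_eq`, hence `0`).

HONEST LIMITS: the converse / positive exponent (`p ∣ c_w ⇒ #H¹(I_w, T_pE)^{Fr} = (c_w)_p > 1`) is NOT
here.  References: K. Rubin, *Euler Systems* (2000) Lemma 1.3.2, Lemma 1.3.5, App. B Prop. B.2.3;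
K. Büyükboduk, JNT 129 (2009) §2.1.2 Remark 2; J. Neukirch, A. Schmidt, K. Wingberg, *Cohomology of
Number Fields* (2008) (2.7.5) (`lim¹`); J. S. Milne, *ADT* I Prop. 3.8 and Remark 3.10.
-/

noncomputable section

-- the cell's Theorems namespace `Summit.BirchSwinnertonDyer.BirchSwinnertonDyer.…` repeats the summit name by design (D-0017)
set_option linter.dupNamespace false

open CategoryTheory Function Field IsDedekindDomain NumberField
open scoped NumberField Classical
open Literature.NumberTheory.GaloisRepresentations Literature.NumberTheory.EllipticCurves
open Literature.NumberTheory.GaloisRepresentations.DiscreteGaloisModule (unramifiedSubgroup)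
open Literature.NumberTheory.GaloisRepresentations.IsNonarchimedeanLocalField
open WeierstrassCurve
open Summit.BirchSwinnertonDyer.Rank1Residual.GaloisImage
open Summit.BirchSwinnertonDyer.Rank1Residual.X11b
open Summit.BirchSwinnertonDyer.BirchSwinnertonDyer.Theorems.KimAtThreeDeepUpperOffStratumLocalIndex
open Summit.BirchSwinnertonDyer.BirchSwinnertonDyer.Theorems.KimAtThreeD7uBlochKatoCondition
open Summit.BirchSwinnertonDyer.BirchSwinnertonDyer.Theorems.KimAtThreeD7uTamagawaFreePlaces
open Summit.BirchSwinnertonDyer.BirchSwinnertonDyer.Theorems.KimAtThreeD7uTamagawaFreeStructures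

namespace Summit.BirchSwinnertonDyer.BirchSwinnertonDyer.Theorems.KimAtThreeD7uTamagawaFreeTate

/-! ### §1 König's lemma for an `ℕ`-tower of finite non-empty sets -/

section Koenig

variable {α : Type*} {S : ℕ → Set α} (f : α → α)

/-- Iterating the transition map `j` times sends `S (n + j)` into `S n`. [folklore] -/
theorem iterate_mem_of_mem_add (hmap : ∀ n, ∀ a ∈ S (n + 1), f a ∈ S n) :
    ∀ (j n : ℕ), ∀ b ∈ S (n + j), f^[j] b ∈ S n := by
  intro j
  induction j with
  | zero => intro n b hb; simpa using hb
  | succ j ih =>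
    intro n b hb
    rw [Function.iterate_succ_apply]
    exact ih n (f b) (hmap (n + j) b (by rw [Nat.add_assoc]; exact hb))

/-- **König's lemma for an `ℕ`-tower of finite non-empty sets.**  If every `S n` is finite and
non-empty and `f` maps `S (n+1)` into `S n`, there is a sequence `a n ∈ S n` with `f (a (n+1)) = a n`
(choose successively elements having pre-images at every higher level; such elements have such
pre-images one level up by the pigeonhole principle on the finite fibre). [folklore] -/
theorem exists_seq_of_finite_tower (hfin : ∀ n, (S n).Finite) (hne : ∀ n, (S n).Nonempty)
    (hmap : ∀ n, ∀ a ∈ S (n + 1), f a ∈ S n) :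
    ∃ a : ℕ → α, (∀ n, a n ∈ S n) ∧ ∀ n, f (a (n + 1)) = a n := by
  have hiter := iterate_mem_of_mem_add f hmap
  -- `P n a j`: `a` has a pre-image `j` levels up
  let P : ℕ → α → ℕ → Prop := fun n a j => ∃ c ∈ S (n + j), f^[j] c = a
  have hPmono : ∀ n a j j', j' ≤ j → P n a j → P n a j' := by
    rintro n a j j' hjj' ⟨c, hc, hca⟩
    refine ⟨f^[j - j'] c, hiter (j - j') (n + j') c (by rw [Nat.add_assoc, Nat.add_sub_cancel' hjj']; exact hc), ?_⟩
    rw [← Function.iterate_add_apply, Nat.add_sub_cancel' hjj', hca]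
  -- extendable elements
  let Ext : ℕ → α → Prop := fun n a => a ∈ S n ∧ ∀ j, P n a j
  -- step: an extendable element has an extendable pre-image
  have hstep : ∀ n a, Ext n a → ∃ b, Ext (n + 1) b ∧ f b = a := by
    rintro n a ⟨-, haP⟩
    by_contra hcon
    -- every candidate `b` (in `S (n+1)` with `f b = a`) fails to extend at some level `jb b`
    have hcon' : ∀ b, ∃ j, b ∈ S (n + 1) → f b = a → ¬ P (n + 1) b j := by
      intro b
      by_contra hb
      push Not at hb
      exact hcon ⟨b, ⟨(hb 0).1, fun j => (hb j).2.2⟩, (hb 0).2.1⟩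
    choose jb hjb using hcon'
    set C : Finset α := (hfin (n + 1)).toFinset.filter (fun b => f b = a) with hCdef
    set J : ℕ := C.sup jb with hJdef
    obtain ⟨c, hc, hca⟩ := haP (J + 1)
    -- `b = f^[J] c` is a candidate with a pre-image `J` levels up
    have hb : f^[J] c ∈ S (n + 1) :=
      hiter J (n + 1) c (by rw [Nat.add_assoc, Nat.add_comm 1 J]; exact hc)
    have hfb : f (f^[J] c) = a := by
      have e : f^[J + 1] c = f (f^[J] c) := Function.iterate_succ_apply' f J c
      rw [← e, hca]
    have hbC : f^[J] c ∈ C := by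
      rw [hCdef, Finset.mem_filter, Set.Finite.mem_toFinset]; exact ⟨hb, hfb⟩
    have hle : jb (f^[J] c) ≤ J := Finset.le_sup hbC
    exact hjb _ hb hfb (hPmono (n + 1) _ J _ hle ⟨c, by rw [Nat.add_assoc, Nat.add_comm 1 J]; exact hc, rfl⟩)
  -- base: an extendable element at level `0`
  have hbase : ∃ a, Ext 0 a := by
    by_contra hcon
    have hcon' : ∀ b, ∃ j, b ∈ S 0 → ¬ P 0 b j := by
      intro b
      by_contra hb
      push Not at hb
      exact hcon ⟨b, (hb 0).1, fun j => (hb j).2⟩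
    choose jb hjb using hcon'
    set J : ℕ := (hfin 0).toFinset.sup jb with hJdef
    obtain ⟨c, hc⟩ := hne J
    have hb : f^[J] c ∈ S 0 := hiter J 0 c (by rw [Nat.zero_add]; exact hc)
    have hle : jb (f^[J] c) ≤ J := Finset.le_sup ((Set.Finite.mem_toFinset _).mpr hb)
    exact hjb _ hb (hPmono 0 _ J _ hle ⟨c, by rw [Nat.zero_add]; exact hc, rfl⟩)
  -- the sequence, by recursion on extendable elements
  let seq : ∀ n : ℕ, {a // Ext n a} := fun n =>
    Nat.rec (motive := fun n => {a // Ext n a}) ⟨Classical.choose hbase, Classical.choose_spec hbase⟩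
      (fun n x => ⟨Classical.choose (hstep n x.1 x.2), (Classical.choose_spec (hstep n x.1 x.2)).1⟩) n
  refine ⟨fun n => (seq n).1, fun n => (seq n).2.1, fun n => ?_⟩
  exact (Classical.choose_spec (hstep n (seq n).1 (seq n).2)).2

end Koenig

/-! ### §2 Every class of `H¹(ℚ_w, T_pE)` is unramified at a Tamagawa-free `w ∤ p` -/

section Tate

variable (W : WeierstrassCurve ℚ) [W.IsElliptic] (p : ℕ) [hp : Fact p.Prime]
  (w : HeightOneSpectrum (𝓞 ℚ))

/-- Local notation: `T_pE|_{Γ_{ℚ_w}}` (= `tateLocalRep W p (Sum.inr w)`, by `rfl`). -/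
local notation3 "𝕋" => (GaloisRep.restrictField (HeightOneSpectrum.adicCompletion ℚ w)
  (WeierstrassCurve.tateGaloisRep W p (W.continuous_galoisRepTate_holds p)).toIntRep)

/-- **`res_{I_w} = 0` on `H¹(ℚ_w, T_pE)` at a Tamagawa-free `w ∤ p`.**  For a finite place `w ∤ p` with
`p ∤ c_w = [E(ℚ_w) : E₀(ℚ_w)]` (tree `localTamagawaNumber`, ANY reduction type) EVERY class
`y ∈ H¹(ℚ_w, T_pE)` restricts to `0` on the inertia group `I_w = absInertia ℚ_w`, i.e. is unramified:
each reduction `π_{k+1,*} y` lies in `𝓕_can(w) = H¹_ur(ℚ_w, E[p^k·p])` (Part II), so a cocycle `η` of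
`y` is, modulo `p^{k+1}`, the coboundary on `I_w` of some `m_k ∈ E[p^k·p]`; König's lemma (§1) on the
finite non-empty sets of such `m_k` yields a compatible `t = (m_k) ∈ T_pE` with `η|_{I_w} = ∂t`.
This is `[H¹(ℚ_w, T_pE) : H¹_ur(ℚ_w, T_pE)] = (c_w)_p` in the case `p ∤ c_w`.
[cite: Rubin2000, Lemma 1.3.5] [cite: NeukirchSchmidtWingberg2008, II §7 (2.7.5)]
[cite: MilneADT2006, Ch. I Prop. 3.8 and Remark 3.10] -/
theorem resSubgroup_absInertia_eq_zero_of_not_dvd_localTamagawaNumber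
    (hw : ((p : ℕ) : 𝓞 ℚ) ∉ w.asIdeal)
    (hc : ¬ p ∣ (W.baseChange (w.adicCompletion ℚ)).localTamagawaNumber (w.adicCompletionIntegers ℚ))
    (y : (tateLocalRep W p (Sum.inr w)).cohomology 1) :
    resSubgroup (tateLocalRep W p (Sum.inr w)).toTopRep (absInertia (w.adicCompletion ℚ)) 1 y = 0 := by
  set F := w.adicCompletion ℚ with hFdef
  set θ : absoluteGaloisGroup F →ₜ* absoluteGaloisGroup ℚ := absGaloisRestrict ℚ F with hθdef
  obtain ⟨η, rfl⟩ := oneCocycleClass_surjective _ y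
  have hp0 : ((p : ℕ) : ℤ) ≠ 0 := by exact_mod_cast hp.out.ne_zero
  -- level `k+1`: `π_{k+1} ∘ η` is the coboundary of some `m ∈ E[p^k · p]` on `I_w`
  have hlevel : ∀ k : ℕ, ∃ m : geomPoints W, m ∈ geomTorsion W ((p : ℤ) ^ k * (p : ℤ)) ∧
      ∀ τ ∈ absInertia F, TateModule.proj p (k + 1) (η.1 τ) = θ τ • m - m := by
    intro k
    have hk : oneCocycleClass _ (pushCocycle W p k (Sum.inr w) η) ∈
        propagatedSelmerStructure W p k (Sum.inr w) :=
      (mem_propagatedSelmerStructure_iff W p k (Sum.inr w) _).mpr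
        ⟨oneCocycleClass _ η, tateLocalMap_oneCocycleClass W p k (Sum.inr w) η⟩
    rw [propagatedSelmerStructure_inr_eq_unramifiedSubgroup_of_not_dvd_localTamagawaNumber W p k w hw hc]
      at hk
    obtain ⟨m, hm⟩ := (LocBridge.mem_unramifiedSubgroup_one_iff_exists
      (GaloisRep.restrictField F (W.torsionGaloisModule ((p : ℤ) ^ k * (p : ℤ))))
      (pushCocycle W p k (Sum.inr w) η)).mp hk
    refine ⟨(m : geomPoints W), m.2, fun τ hτ => ?_⟩
    have h := congrArg (fun z : geomTorsion W ((p : ℤ) ^ k * (p : ℤ)) => (z : geomPoints W)) (hm τ hτ)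
    rw [AddSubgroupClass.coe_sub, coe_restrictField_torsion_apply] at h
    exact (show TateModule.proj p (k + 1) (η.1 τ) =
      ((pushCocycle W p k (Sum.inr w) η).1 τ : geomPoints W) from rfl).trans h
  -- the tower of admissible reductions: `S 0 = {0}`, `S (k+1) = {m ∈ E[p^k·p] | π_{k+1}∘η|_I = ∂m}`
  let S : ℕ → Set (geomPoints W) := fun n => Nat.casesOn n {0} fun k =>
    {m | m ∈ geomTorsion W ((p : ℤ) ^ k * (p : ℤ)) ∧
      ∀ τ ∈ absInertia F, TateModule.proj p (k + 1) (η.1 τ) = θ τ • m - m}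
  have hS0 : S 0 = {0} := rfl
  have hSsucc : ∀ k, S (k + 1) = {m | m ∈ geomTorsion W ((p : ℤ) ^ k * (p : ℤ)) ∧
      ∀ τ ∈ absInertia F, TateModule.proj p (k + 1) (η.1 τ) = θ τ • m - m} := fun k => rfl
  have hfin : ∀ n, (S n).Finite := by
    intro n
    cases n with
    | zero => rw [hS0]; exact Set.finite_singleton 0
    | succ k =>
      rw [hSsucc]
      have hne : ((p ^ (k + 1) : ℕ) : ℤ) ≠ 0 := by exact_mod_cast pow_ne_zero (k + 1) hp.out.ne_zero
      haveI : Finite (geomTorsion W ((p ^ (k + 1) : ℕ) : ℤ)) :=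
        finite_torsionPoints_holds W (AlgebraicClosure ℚ) hne
      have hfinT : ((geomTorsion W ((p ^ (k + 1) : ℕ) : ℤ) : AddSubgroup (geomPoints W)) :
          Set (geomPoints W)).Finite := Set.toFinite _
      refine hfinT.subset fun m hm => ?_
      exact (mem_geomTorsion_pow_mul_iff W p k m).mp hm.1
  have hne : ∀ n, (S n).Nonempty := by
    intro n
    cases n with
    | zero => exact ⟨0, by rw [hS0]; exact Set.mem_singleton 0⟩
    | succ k =>
      obtain ⟨m, hm, hmI⟩ := hlevel k
      exact ⟨m, by rw [hSsucc]; exact ⟨hm, hmI⟩⟩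
  have hmap : ∀ n, ∀ a ∈ S (n + 1), (p : ℤ) • a ∈ S n := by
    intro n a ha
    rw [hSsucc] at ha
    obtain ⟨haT, haI⟩ := ha
    cases n with
    | zero =>
      rw [hS0, Set.mem_singleton_iff]
      rw [mem_geomTorsion_iff, pow_zero, one_mul] at haT
      exact haT
    | succ k =>
      rw [hSsucc]
      refine ⟨zsmul_mem_geomTorsion_level W p k haT, fun τ hτ => ?_⟩
      rw [← TateModule.smul_proj_succ, haI τ hτ, smul_sub, natCast_zsmul, smul_comm]
  obtain ⟨a, haS, ha⟩ := exists_seq_of_finite_tower (fun m : geomPoints W => (p : ℤ) • m) hfin hne hmap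
  -- the Tate vector `t = (a n)_n`
  have ha0 : a 0 = 0 := by have h := haS 0; rwa [hS0, Set.mem_singleton_iff] at h
  have hator : ∀ n, p ^ n • a n = 0 := by
    intro n
    cases n with
    | zero => rw [ha0, smul_zero]
    | succ k =>
      have h := haS (k + 1)
      rw [hSsucc] at h
      have h' := (mem_geomTorsion_pow_mul_iff W p k (a (k + 1))).mp h.1
      rw [mem_geomTorsion_iff, natCast_zsmul] at h'
      exact h'
  have hacompat : ∀ n, p • a (n + 1) = a n := fun n => by rw [← natCast_zsmul]; exact ha n
  let t : W.tateModule p := TateModule.mk a hator hacompat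
  -- `η|_{I_w} = ∂t`
  have hprin : ∀ τ ∈ absInertia F, η.1 τ = (tateLocalRep W p (Sum.inr w)).toTopRep.ρ τ t - t := by
    intro τ hτ
    change η.1 τ = θ τ • t - t
    refine TateModule.ext fun n => ?_
    rw [map_sub, TateModule.proj_smul_of_distribMulAction, TateModule.proj_mk]
    cases n with
    | zero =>
      rw [ha0, smul_zero, sub_zero]
      have h := TateModule.pow_smul_proj 0 (η.1 τ)
      rwa [pow_zero, one_smul] at h
    | succ k =>
      have h := haS (k + 1)
      rw [hSsucc] at h
      exact h.2 τ hτ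
  rw [resSubgroup_oneCocycleClass, oneCocycleClass_eq_zero_iff]
  exact ⟨t, fun n => by rw [resSubgroup_pullback_apply, subgroupRep_ρ_apply]; exact hprin _ n.2⟩

/-! ### §3 `H¹_ur(ℚ_w, T_pE) = H¹(ℚ_w, T_pE)` and `H¹(I_w, T_pE)^{Fr} = 0` -/

/-- **`H¹_ur(ℚ_w, T_pE) = H¹(ℚ_w, T_pE)` at a Tamagawa-free `w ∤ p`**: the tree's `unramifiedSubgroup`
(kernel of the pull-back to `Γ_{ℚ_w^{nr}}`) of `T_pE|_{Γ_{ℚ_w}}` is everything when `p ∤ c_w`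
(§2 + gen 2's `mem_unramifiedSubgroup_iff_resSubgroup_absInertia_eq_zero`).  For the Bloch–Kato datum
`π_{k+1}` this re-proves `finiteSubgroup = π_* H¹ = 𝓕_can(w)` (Part II).
[cite: Rubin2000, Lemma 1.3.5] [cite: MilneADT2006, Ch. I Prop. 3.8 and Remark 3.10] -/
theorem unramifiedSubgroup_tate_eq_top_of_not_dvd_localTamagawaNumber
    (hw : ((p : ℕ) : 𝓞 ℚ) ∉ w.asIdeal)
    (hc : ¬ p ∣ (W.baseChange (w.adicCompletion ℚ)).localTamagawaNumber (w.adicCompletionIntegers ℚ)) :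
    GaloisRep.unramifiedSubgroup (𝕋) 1 = ⊤ := by
  rw [eq_top_iff]
  intro y _
  exact (mem_unramifiedSubgroup_iff_resSubgroup_absInertia_eq_zero W p w y).mpr
    (resSubgroup_absInertia_eq_zero_of_not_dvd_localTamagawaNumber W p w hw hc y)

/-- **`H¹(I_w, T_pE)^{Fr} = 0` at a Tamagawa-free `w ∤ p`** — the `p ∤ c_w` case of the E-specific
order `#H¹(I_w, T_pE)^{Fr} = (c_w)_p` left open by w2-acc5 g3's local index package: a class of
`H¹(I_w, T_pE)` fixed by (conjugation by) an arithmetic Frobenius lift `φ` is the restriction of a class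
of `H¹(ℚ_w, T_pE)` (`exists_resSubgroup_inertia_eq_of_conjMap_eq`, `cd Ẑ = 1`), and every such
restriction vanishes (§2).  [cite: Rubin2000, Lemma 1.3.2 (i), Lemma 1.3.5]
[cite: MilneADT2006, Ch. I Prop. 3.8 and Remark 3.10] -/
theorem eq_zero_of_conjMap_eq_of_not_dvd_localTamagawaNumber
    (hw : ((p : ℕ) : 𝓞 ℚ) ∉ w.asIdeal)
    (hc : ¬ p ∣ (W.baseChange (w.adicCompletion ℚ)).localTamagawaNumber (w.adicCompletionIntegers ℚ))
    {φ : absoluteGaloisGroup (w.adicCompletion ℚ)} (hφ : IsFrobPow φ 1)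
    (yc : continuousCohomology 1 (subgroupRep (𝕋).toTopRep (absInertia (w.adicCompletion ℚ))))
    (hinv : haveI : (absInertia (w.adicCompletion ℚ)).Normal := absInertia_normal_holds _
      conjMap (𝕋).toTopRep (absInertia (w.adicCompletion ℚ)) φ 1 yc = yc) :
    yc = 0 := by
  obtain ⟨xc, hxc⟩ := exists_resSubgroup_inertia_eq_of_conjMap_eq W p w hφ yc hinv
  rw [← hxc]
  exact resSubgroup_absInertia_eq_zero_of_not_dvd_localTamagawaNumber W p w hw hc xc

/-- The same with Frobenius-invariance asked for EVERY element of `Γ_{ℚ_w}` (the form of acc5's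
`exists_resSubgroup_inertia_eq_iff_forall_conjMap_eq`): the `Γ_{ℚ_w}/I_w`-invariants of
`H¹(I_w, T_pE)` vanish at a Tamagawa-free `w ∤ p`. [cite: Rubin2000, Lemma 1.3.2 (i), Lemma 1.3.5] -/
theorem eq_zero_of_forall_conjMap_eq_of_not_dvd_localTamagawaNumber
    (hw : ((p : ℕ) : 𝓞 ℚ) ∉ w.asIdeal)
    (hc : ¬ p ∣ (W.baseChange (w.adicCompletion ℚ)).localTamagawaNumber (w.adicCompletionIntegers ℚ))
    (yc : continuousCohomology 1 (subgroupRep (𝕋).toTopRep (absInertia (w.adicCompletion ℚ))))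
    (hinv : ∀ g : absoluteGaloisGroup (w.adicCompletion ℚ),
      haveI : (absInertia (w.adicCompletion ℚ)).Normal := absInertia_normal_holds _
      conjMap (𝕋).toTopRep (absInertia (w.adicCompletion ℚ)) g 1 yc = yc) :
    yc = 0 := by
  obtain ⟨xc, hxc⟩ := (exists_resSubgroup_inertia_eq_iff_forall_conjMap_eq W p w yc).mpr hinv
  rw [← hxc]
  exact resSubgroup_absInertia_eq_zero_of_not_dvd_localTamagawaNumber W p w hw hc xc

end Tate

end Summit.BirchSwinnertonDyer.BirchSwinnertonDyer.Theorems.KimAtThreeD7uTamagawaFreeTate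

end
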